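import Mathlib.Algebra.BigOperators.Ring.Finset
import Mathlib.Algebra.Order.BigOperators.Group.Finset
import Mathlib.Probability.ProbabilityMassFunction.Constructions
import Literature.Computability.Complexity.AOWRefutation
import HarnessLib

/-!
# The product law `subsetPMF`: expectations, independent centred indicators, Markov
(plumbing for Allen–O'Donnell–Witmer 2015, Def. 3.1 / Fact 3.6)

Trunk T-CPLX-CORE (Literature/Computability/Complexity). Support file for the discharge of the
named fact `allen_odonnell_witmer_kSAT` (`AOWRefutation.lean`), probabilistic part I.

AOW's random model `F_P(n,p)` includes each constraint independently with probability `p`; the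
tree renders it as the honest `PMF` `subsetPMF ι p` on `Finset ι` (`AOWRefutation.lean`). This
file provides the finite-sum calculus used by the moment method:

* `subsetExp ι p f = ∑_T P(T) f(T)` — expectation of a real function of the random subset;
  linear, monotone, `subsetExp 1 = 1`;
* `subsetExp_prod` — **independence of the coordinates**:
  `E[∏_i g_i(1[i ∈ T])] = ∏_i (p g_i(1) + (1-p) g_i(0))`;
* `bernMoment p a = E[(ξ - p)^a]` for `ξ ∼ Bernoulli(p)`: `bernMoment p 1 = 0`,
  `|bernMoment p a| ≤ p` (`a ≥ 2`), and `subsetExp_prod_centred_pow`: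
  `E[∏_i (1[i∈T] - p)^{a_i}] = ∏_i bernMoment p a_i`;
* `subsetExp_prod_centred_seq_eq_zero` / `abs_subsetExp_prod_centred_seq_le` — for a SEQUENCE of
  labels `lab : Fin m → ι`: `E[∏_t (1[lab t ∈ T] - p)]` vanishes if some label occurs exactly
  once, and is at most `p^{#distinct labels}` in absolute value (the two facts driving the trace
  method);
* `subsetProb` and **Markov's inequality** `subsetProb_le_subsetExp_div`, the bridge
  `toOuterMeasure_subsetPMF` to `PMF.toOuterMeasure`, and the mean/variance of `|T|`
  (`subsetExp_card`, `subsetExp_card_sub_sq`) with **Chebyshev** for the number of constraints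
  (AOW Fact 3.6, first item, in Chebyshev form).

## References

* S. R. Allen, R. O'Donnell, D. Witmer, *How to refute a random CSP*, FOCS 2015,
  arXiv:1505.04383: Def. 3.1 (`F_P(n,p)`), Fact 3.6 (concentration of `m`), App. A.4 (moment
  computations `E[P_{J,L}] ≤ p^{#distinct factors}`, `= 0` if a factor occurs once).
* W. Feller, *An Introduction to Probability Theory and its Applications* I, 3rd ed., §IX
  (Markov and Chebyshev inequalities).
-/

noncomputable section

namespace Literature.Computability.Complexity

open Finset

variable {ι : Type} [Fintype ι]

/-! ### The weights -/

/-- For `0 ≤ p ≤ 1` the clamped inclusion probability is `p`. [folklore] -/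
theorem clampENNReal_toReal {p : ℝ} (hp0 : 0 ≤ p) (hp1 : p ≤ 1) : (clampENNReal p).toReal = p := by
  rw [clampENNReal, min_eq_left hp1, ENNReal.toReal_ofReal hp0]

/-- The real weight of a subset: `P(T) = p^{|T|} (1-p)^{|ι| - |T|}`.
[Allen–O'Donnell–Witmer 2015, Def. 3.1] [folklore] -/
theorem subsetPMF_toReal {p : ℝ} (hp0 : 0 ≤ p) (hp1 : p ≤ 1) (T : Finset ι) :
    (subsetPMF ι p T).toReal = p ^ T.card * (1 - p) ^ (Fintype.card ι - T.card) := by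
  rw [subsetPMF, PMF.ofFintype_apply, ENNReal.toReal_mul, ENNReal.toReal_pow, ENNReal.toReal_pow,
    ENNReal.toReal_sub_of_le (clampENNReal_le_one p) ENNReal.one_ne_top, ENNReal.toReal_one,
    clampENNReal_toReal hp0 hp1]

/-! ### Expectation -/

/-- **Expectation** of a real function of the random subset `T ∼ subsetPMF ι p`:
`E[f] = ∑_T P(T) f(T)`. [Allen–O'Donnell–Witmer 2015, Def. 3.1] [folklore] -/
def subsetExp (ι : Type) [Fintype ι] (p : ℝ) (f : Finset ι → ℝ) : ℝ :=
  ∑ T : Finset ι, (subsetPMF ι p T).toReal * f T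

/-- The weights are nonnegative. [folklore] -/
theorem subsetPMF_toReal_nonneg (p : ℝ) (T : Finset ι) : 0 ≤ (subsetPMF ι p T).toReal :=
  ENNReal.toReal_nonneg

/-- Linearity: `E[f + g] = E[f] + E[g]`. [folklore] -/
theorem subsetExp_add (p : ℝ) (f g : Finset ι → ℝ) :
    subsetExp ι p (fun T => f T + g T) = subsetExp ι p f + subsetExp ι p g := by
  simp only [subsetExp, mul_add, Finset.sum_add_distrib]

/-- Linearity: `E[∑_s f_s] = ∑_s E[f_s]`. [folklore] -/
theorem subsetExp_sum {κ : Type} (p : ℝ) (s : Finset κ) (f : κ → Finset ι → ℝ) :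
    subsetExp ι p (fun T => ∑ x ∈ s, f x T) = ∑ x ∈ s, subsetExp ι p (f x) := by
  simp only [subsetExp, Finset.mul_sum]
  rw [Finset.sum_comm]

/-- Linearity: `E[c f] = c E[f]`. [folklore] -/
theorem subsetExp_const_mul (p c : ℝ) (f : Finset ι → ℝ) :
    subsetExp ι p (fun T => c * f T) = c * subsetExp ι p f := by
  simp only [subsetExp, Finset.mul_sum]
  exact Finset.sum_congr rfl fun T _ => by ring

/-- Linearity: `E[-f] = -E[f]`. [folklore] -/
theorem subsetExp_neg (p : ℝ) (f : Finset ι → ℝ) :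
    subsetExp ι p (fun T => -f T) = -subsetExp ι p f := by
  simp only [subsetExp, mul_neg, Finset.sum_neg_distrib]

/-- Linearity: `E[f - g] = E[f] - E[g]`. [folklore] -/
theorem subsetExp_sub (p : ℝ) (f g : Finset ι → ℝ) :
    subsetExp ι p (fun T => f T - g T) = subsetExp ι p f - subsetExp ι p g := by
  simp only [subsetExp, mul_sub, Finset.sum_sub_distrib]

/-- Monotonicity: `f ≤ g ⟹ E[f] ≤ E[g]`. [folklore] -/
theorem subsetExp_mono (p : ℝ) {f g : Finset ι → ℝ} (h : ∀ T, f T ≤ g T) :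
    subsetExp ι p f ≤ subsetExp ι p g :=
  Finset.sum_le_sum fun T _ => mul_le_mul_of_nonneg_left (h T) (subsetPMF_toReal_nonneg p T)

/-- `E[f] ≥ 0` for `f ≥ 0`. [folklore] -/
theorem subsetExp_nonneg (p : ℝ) {f : Finset ι → ℝ} (h : ∀ T, 0 ≤ f T) : 0 ≤ subsetExp ι p f :=
  Finset.sum_nonneg fun T _ => mul_nonneg (subsetPMF_toReal_nonneg p T) (h T)

/-- `|E[f]| ≤ E[|f|]`. [folklore] -/
theorem abs_subsetExp_le (p : ℝ) (f : Finset ι → ℝ) :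
    |subsetExp ι p f| ≤ subsetExp ι p fun T => |f T| := by
  refine (Finset.abs_sum_le_sum_abs _ _).trans (le_of_eq (Finset.sum_congr rfl fun T _ => ?_))
  rw [abs_mul, abs_of_nonneg (subsetPMF_toReal_nonneg p T)]

variable [DecidableEq ι]

/-- The weight as a product over coordinates: `P(T) = (∏_{i ∈ T} p) (∏_{i ∉ T} (1-p))`. [folklore] -/
theorem subsetPMF_toReal_eq_prod {p : ℝ} (hp0 : 0 ≤ p) (hp1 : p ≤ 1)
    (T : Finset ι) :
    (subsetPMF ι p T).toReal = (∏ _i ∈ T, p) * ∏ _i ∈ Tᶜ, (1 - p) := by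
  rw [subsetPMF_toReal hp0 hp1, Finset.prod_const, Finset.prod_const, Finset.card_compl]

/-- **Independence of the coordinates (product formula)**: for `0 ≤ p ≤ 1`,
`E[∏_i g_i(1[i ∈ T])] = ∏_i (p · g_i(true) + (1-p) · g_i(false))`.
[Allen–O'Donnell–Witmer 2015, Def. 3.1 ("independently with probability `p`")] [folklore] -/
theorem subsetExp_prod {p : ℝ} (hp0 : 0 ≤ p) (hp1 : p ≤ 1) (g : ι → Bool → ℝ) :
    subsetExp ι p (fun T => ∏ i, g i (decide (i ∈ T))) =
      ∏ i, (p * g i true + (1 - p) * g i false) := by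
  unfold subsetExp
  rw [Fintype.prod_add]
  refine Finset.sum_congr rfl fun T _ => ?_
  dsimp only
  rw [subsetPMF_toReal_eq_prod hp0 hp1, ← Finset.prod_mul_prod_compl T fun i => g i (decide (i ∈ T)),
    mul_mul_mul_comm, ← Finset.prod_mul_distrib, ← Finset.prod_mul_distrib]
  congr 1
  · exact Finset.prod_congr rfl fun i hi => by rw [decide_eq_true hi]
  · exact Finset.prod_congr rfl fun i hi => by rw [decide_eq_false (Finset.mem_compl.1 hi)]

/-- `E[1] = 1` (total mass). [folklore] -/
theorem subsetExp_one {p : ℝ} (hp0 : 0 ≤ p) (hp1 : p ≤ 1) :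
    subsetExp ι p (fun _ => 1) = 1 := by
  have h := subsetExp_prod hp0 hp1 (fun (_ : ι) (_ : Bool) => (1 : ℝ))
  simp only [Finset.prod_const_one, mul_one] at h
  rw [h]
  exact Finset.prod_eq_one fun i _ => by ring

/-- `E[c] = c`. [folklore] -/
theorem subsetExp_const {p : ℝ} (hp0 : 0 ≤ p) (hp1 : p ≤ 1) (c : ℝ) :
    subsetExp ι p (fun _ => c) = c := by
  have h := subsetExp_const_mul p c (fun _ : Finset ι => (1 : ℝ))
  simp only [mul_one] at h
  rw [h, subsetExp_one hp0 hp1, mul_one]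

/-! ### Centred moments of a Bernoulli variable -/

/-- The indicator `1[i ∈ T]` as a real number. [folklore] -/
def ind (T : Finset ι) (i : ι) : ℝ := if i ∈ T then 1 else 0

omit [Fintype ι] in
/-- `0 ≤ ind T i ≤ 1`. [folklore] -/
theorem ind_nonneg (T : Finset ι) (i : ι) : 0 ≤ ind T i := by
  unfold ind; split_ifs <;> norm_num

omit [Fintype ι] in
/-- `ind T i ≤ 1`. [folklore] -/
theorem ind_le_one (T : Finset ι) (i : ι) : ind T i ≤ 1 := by
  unfold ind; split_ifs <;> norm_num

/-- The `a`-th centred moment of a Bernoulli(`p`) variable: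
`E[(ξ - p)^a] = p (1-p)^a + (1-p) (-p)^a`. [Feller I, §IX; Allen–O'Donnell–Witmer 2015, App. A.4] [folklore] -/
def bernMoment (p : ℝ) (a : ℕ) : ℝ := p * (1 - p) ^ a + (1 - p) * (-p) ^ a

/-- `E[(ξ-p)^0] = 1`. [folklore] -/
@[simp] theorem bernMoment_zero (p : ℝ) : bernMoment p 0 = 1 := by
  simp [bernMoment]

/-- `E[ξ - p] = 0` (the indicators are centred). [Allen–O'Donnell–Witmer 2015, App. A
(`E[w(T)] = 0`)] [folklore] -/
@[simp] theorem bernMoment_one (p : ℝ) : bernMoment p 1 = 0 := by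
  simp [bernMoment]; ring

/-- `E[(ξ-p)^2] = p (1-p)`. [folklore] -/
theorem bernMoment_two (p : ℝ) : bernMoment p 2 = p * (1 - p) := by
  simp [bernMoment]; ring

/-- `|E[(ξ-p)^a]| ≤ p` for `a ≥ 2` and `0 ≤ p ≤ 1` (indeed `≤ p(1-p)`).
[Allen–O'Donnell–Witmer 2015, App. A.4 (`E[P_{J,L}] ≤ p^{#distinct factors}`)] [folklore] -/
theorem abs_bernMoment_le {p : ℝ} (hp0 : 0 ≤ p) (hp1 : p ≤ 1) {a : ℕ} (ha : 2 ≤ a) :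
    |bernMoment p a| ≤ p := by
  obtain ⟨b, rfl⟩ := Nat.exists_eq_add_of_le ha
  have h1p : 0 ≤ 1 - p := sub_nonneg.2 hp1
  rw [bernMoment]
  calc |p * (1 - p) ^ (2 + b) + (1 - p) * (-p) ^ (2 + b)|
      ≤ |p * (1 - p) ^ (2 + b)| + |(1 - p) * (-p) ^ (2 + b)| := abs_add_le _ _
    _ = p * (1 - p) * ((1 - p) ^ (b + 1) + p ^ (b + 1)) := by
        rw [abs_mul, abs_mul, abs_pow, abs_pow, abs_neg, abs_of_nonneg hp0, abs_of_nonneg h1p]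
        ring
    _ ≤ p * (1 - p) * ((1 - p) + p) := by
        apply mul_le_mul_of_nonneg_left _ (mul_nonneg hp0 h1p)
        exact add_le_add (pow_le_of_le_one h1p (by linarith) (Nat.succ_ne_zero b))
          (pow_le_of_le_one hp0 hp1 (Nat.succ_ne_zero b))
    _ ≤ p := by nlinarith

/-- `|E[(ξ-p)^a]| ≤ 1` for all `a` (`0 ≤ p ≤ 1`). [folklore] -/
theorem abs_bernMoment_le_one {p : ℝ} (hp0 : 0 ≤ p) (hp1 : p ≤ 1) (a : ℕ) :
    |bernMoment p a| ≤ 1 := by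
  have h1p : 0 ≤ 1 - p := sub_nonneg.2 hp1
  rw [bernMoment]
  calc |p * (1 - p) ^ a + (1 - p) * (-p) ^ a|
      ≤ |p * (1 - p) ^ a| + |(1 - p) * (-p) ^ a| := abs_add_le _ _
    _ = p * (1 - p) ^ a + (1 - p) * p ^ a := by
        rw [abs_mul, abs_mul, abs_pow, abs_pow, abs_neg, abs_of_nonneg hp0, abs_of_nonneg h1p]
    _ ≤ p * 1 + (1 - p) * 1 := add_le_add
        (mul_le_mul_of_nonneg_left (pow_le_one₀ h1p (by linarith)) hp0)
        (mul_le_mul_of_nonneg_left (pow_le_one₀ hp0 hp1) h1p)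
    _ = 1 := by ring

/-- **Moments of independent centred indicators**:
`E[∏_i (1[i∈T] - p)^{a_i}] = ∏_i bernMoment p a_i`. [Allen–O'Donnell–Witmer 2015, App. A.4] [folklore] -/
theorem subsetExp_prod_centred_pow {p : ℝ} (hp0 : 0 ≤ p) (hp1 : p ≤ 1)
    (a : ι → ℕ) :
    subsetExp ι p (fun T => ∏ i, (ind T i - p) ^ a i) = ∏ i, bernMoment p (a i) := by
  unfold subsetExp bernMoment
  rw [Fintype.prod_add]
  refine Finset.sum_congr rfl fun T _ => ?_
  dsimp only
  rw [subsetPMF_toReal_eq_prod hp0 hp1, ← Finset.prod_mul_prod_compl T fun i => (ind T i - p) ^ a i,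
    mul_mul_mul_comm, ← Finset.prod_mul_distrib, ← Finset.prod_mul_distrib]
  congr 1
  · exact Finset.prod_congr rfl fun i hi => by rw [ind, if_pos hi]
  · exact Finset.prod_congr rfl fun i hi => by rw [ind, if_neg (Finset.mem_compl.1 hi), zero_sub]

/-! ### Products along a sequence of labels -/

section Seq

variable {m : ℕ}

/-- The multiplicity of the label `i` in the sequence `lab`. [folklore] -/
def labelCount (lab : Fin m → ι) (i : ι) : ℕ := (univ.filter fun t => lab t = i).card

/-- `∏_t h(lab t) = ∏_i h(i)^{count i}`. [folklore] -/
theorem prod_seq_eq_prod_pow_labelCount (lab : Fin m → ι) (h : ι → ℝ) :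
    ∏ t, h (lab t) = ∏ i, h i ^ labelCount lab i := by
  rw [Finset.prod_comp]
  refine Finset.prod_subset (Finset.subset_univ _) fun i _ hi => ?_
  have h0 : labelCount lab i = 0 := by
    rw [labelCount, Finset.card_eq_zero, Finset.filter_eq_empty_iff]
    intro t _ ht
    exact hi (Finset.mem_image.2 ⟨t, Finset.mem_univ _, ht⟩)
  unfold labelCount at h0
  rw [h0, pow_zero]

/-- **Expectation of a product along a label sequence**:
`E[∏_t (1[lab t ∈ T] - p)] = ∏_i bernMoment p (count i)`. [Allen–O'Donnell–Witmer 2015,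
App. A.4] [folklore] -/
theorem subsetExp_prod_centred_seq {p : ℝ} (hp0 : 0 ≤ p) (hp1 : p ≤ 1) (lab : Fin m → ι) :
    subsetExp ι p (fun T => ∏ t, (ind T (lab t) - p)) = ∏ i, bernMoment p (labelCount lab i) := by
  rw [← subsetExp_prod_centred_pow hp0 hp1]
  exact congr_arg _ (funext fun T => prod_seq_eq_prod_pow_labelCount lab fun i => ind T i - p)

/-- **Vanishing**: if some label occurs exactly once in the sequence, the expectation of the
product of centred indicators is `0`. [Allen–O'Donnell–Witmer 2015, App. A.4 (Claim: a factor
occurring exactly once kills `E[P_{J,L}]`)] [cite: arXiv150504383, App. A] -/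
theorem subsetExp_prod_centred_seq_eq_zero {p : ℝ} (hp0 : 0 ≤ p) (hp1 : p ≤ 1) (lab : Fin m → ι)
    {i : ι} (hi : labelCount lab i = 1) :
    subsetExp ι p (fun T => ∏ t, (ind T (lab t) - p)) = 0 := by
  rw [subsetExp_prod_centred_seq hp0 hp1]
  exact Finset.prod_eq_zero (Finset.mem_univ i) (by rw [hi, bernMoment_one])

/-- **Moment bound**: `|E[∏_t (1[lab t ∈ T] - p)]| ≤ p^{#distinct labels}`.
[Allen–O'Donnell–Witmer 2015, App. A.4 (`E[P_{J,L}] ≤ p^{#distinct factors}`)] [cite: arXiv150504383, App. A] -/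
theorem abs_subsetExp_prod_centred_seq_le {p : ℝ} (hp0 : 0 ≤ p) (hp1 : p ≤ 1) (lab : Fin m → ι) :
    |subsetExp ι p (fun T => ∏ t, (ind T (lab t) - p))| ≤ p ^ (univ.image lab).card := by
  by_cases h1 : ∃ i, labelCount lab i = 1
  · obtain ⟨i, hi⟩ := h1
    rw [subsetExp_prod_centred_seq_eq_zero hp0 hp1 lab hi, abs_zero]
    positivity
  push Not at h1
  rw [subsetExp_prod_centred_seq hp0 hp1, Finset.abs_prod]
  -- split the product into labels that occur and labels that do not
  have hsplit : ∏ i, |bernMoment p (labelCount lab i)| =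
      ∏ i ∈ univ.image lab, |bernMoment p (labelCount lab i)| := by
    symm
    apply Finset.prod_subset (Finset.subset_univ _)
    intro i _ hi
    have h0 : labelCount lab i = 0 := by
      rw [labelCount, Finset.card_eq_zero, Finset.filter_eq_empty_iff]
      intro t _ ht
      exact hi (Finset.mem_image.2 ⟨t, Finset.mem_univ _, ht⟩)
    rw [h0, bernMoment_zero, abs_one]
  rw [hsplit, ← Finset.prod_const]
  refine Finset.prod_le_prod (fun i _ => abs_nonneg _) fun i hi => ?_
  -- an occurring label occurs at least twice
  have hpos : 0 < labelCount lab i := by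
    obtain ⟨t, -, rfl⟩ := Finset.mem_image.1 hi
    exact Finset.card_pos.2 ⟨t, by simp⟩
  have h2 : 2 ≤ labelCount lab i := by
    have := h1 i
    omega
  exact abs_bernMoment_le hp0 hp1 h2

end Seq

/-! ### Probabilities, Markov, Chebyshev -/

/-- The probability of an event under `subsetPMF`, as a real number (`E[1_E]`).
[Allen–O'Donnell–Witmer 2015, Def. 3.1] [folklore] -/
def subsetProb (ι : Type) [Fintype ι] (p : ℝ) (E : Finset ι → Prop) [DecidablePred E] : ℝ :=
  subsetExp ι p fun T => if E T then 1 else 0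

omit [DecidableEq ι] in
/-- Bridge to Mathlib: `P(E)` is the (real value of the) outer measure of `E` under `subsetPMF`.
[Mathlib `PMF.toOuterMeasure_apply_fintype`] [folklore] -/
theorem toOuterMeasure_subsetPMF_toReal (p : ℝ) (E : Set (Finset ι)) [DecidablePred (· ∈ E)] :
    ((subsetPMF ι p).toOuterMeasure E).toReal = subsetProb ι p (· ∈ E) := by
  rw [PMF.toOuterMeasure_apply_fintype, ENNReal.toReal_sum fun T _ => ?_]
  · unfold subsetProb subsetExp
    refine Finset.sum_congr rfl fun T _ => ?_
    dsimp only
    by_cases hT : T ∈ E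
    · rw [Set.indicator_of_mem hT, if_pos hT, mul_one]
    · rw [Set.indicator_of_notMem hT, if_neg hT, mul_zero, ENNReal.toReal_zero]
  · exact ne_top_of_le_ne_top ENNReal.one_ne_top
      ((Set.indicator_le_self _ _ T).trans (PMF.coe_le_one _ T))

omit [DecidableEq ι] in
/-- `0 ≤ P(E)`. [folklore] -/
theorem subsetProb_nonneg (p : ℝ) (E : Finset ι → Prop) [DecidablePred E] : 0 ≤ subsetProb ι p E :=
  subsetExp_nonneg p fun T => by split_ifs <;> norm_num

/-- `P(E) ≤ 1` for `0 ≤ p ≤ 1`. [folklore] -/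
theorem subsetProb_le_one {p : ℝ} (hp0 : 0 ≤ p) (hp1 : p ≤ 1) (E : Finset ι → Prop)
    [DecidablePred E] : subsetProb ι p E ≤ 1 := by
  rw [← subsetExp_one (ι := ι) hp0 hp1]
  exact subsetExp_mono p fun T => by split_ifs <;> norm_num

omit [DecidableEq ι] in
/-- Monotonicity of probability under implication. [folklore] -/
theorem subsetProb_mono (p : ℝ) {E F : Finset ι → Prop} [DecidablePred E] [DecidablePred F]
    (h : ∀ T, E T → F T) : subsetProb ι p E ≤ subsetProb ι p F :=
  subsetExp_mono p fun T => by
    by_cases hE : E T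
    · rw [if_pos hE, if_pos (h T hE)]
    · rw [if_neg hE]; split_ifs <;> norm_num

omit [DecidableEq ι] in
/-- **Union bound** for two events. [folklore] -/
theorem subsetProb_or_le (p : ℝ) (E F : Finset ι → Prop) [DecidablePred E] [DecidablePred F] :
    subsetProb ι p (fun T => E T ∨ F T) ≤ subsetProb ι p E + subsetProb ι p F := by
  rw [subsetProb, subsetProb, subsetProb, ← subsetExp_add]
  exact subsetExp_mono p fun T => by
    by_cases hE : E T <;> by_cases hF : F T <;> simp [hE, hF]

omit [DecidableEq ι] in
/-- Events that agree pointwise have the same probability (whatever the decidability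
instances). [folklore] -/
theorem subsetProb_congr (p : ℝ) {E F : Finset ι → Prop} [DecidablePred E] [DecidablePred F]
    (h : ∀ T, E T ↔ F T) : subsetProb ι p E = subsetProb ι p F := by
  unfold subsetProb
  congr 1
  funext T
  by_cases hE : E T
  · rw [if_pos hE, if_pos ((h T).1 hE)]
  · rw [if_neg hE, if_neg (mt (h T).2 hE)]

omit [DecidableEq ι] in
/-- The impossible event has probability `0`. [folklore] -/
theorem subsetProb_false (p : ℝ) : subsetProb ι p (fun _ => False) = 0 := by
  simp [subsetProb, subsetExp]

omit [DecidableEq ι] in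
/-- **Union bound** over a finite family. [folklore] -/
theorem subsetProb_exists_le {κ : Type} (p : ℝ) (s : Finset κ) (E : κ → Finset ι → Prop)
    [∀ x, DecidablePred (E x)] :
    subsetProb ι p (fun T => ∃ x ∈ s, E x T) ≤ ∑ x ∈ s, subsetProb ι p (E x) := by
  classical
  induction s using Finset.induction_on with
  | empty =>
    rw [Finset.sum_empty, subsetProb_congr p (F := fun _ => False) (fun T => by simp),
      subsetProb_false]
  | insert x s hx ih =>
    rw [Finset.sum_insert hx,
      subsetProb_congr p (F := fun T => E x T ∨ ∃ y ∈ s, E y T) (fun T => by simp)]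
    calc subsetProb ι p (fun T => E x T ∨ ∃ y ∈ s, E y T)
        ≤ subsetProb ι p (E x) + subsetProb ι p (fun T => ∃ y ∈ s, E y T) := subsetProb_or_le p _ _
      _ ≤ subsetProb ι p (E x) + ∑ y ∈ s, subsetProb ι p (E y) := by linarith [ih]

/-- The complement: `P(¬E) = 1 - P(E)` (`0 ≤ p ≤ 1`). [folklore] -/
theorem subsetProb_not {p : ℝ} (hp0 : 0 ≤ p) (hp1 : p ≤ 1) (E : Finset ι → Prop)
    [DecidablePred E] : subsetProb ι p (fun T => ¬ E T) = 1 - subsetProb ι p E := by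
  rw [← subsetExp_one (ι := ι) hp0 hp1, subsetProb, subsetProb, ← subsetExp_sub]
  congr 1
  funext T
  by_cases hE : E T <;> simp [hE]

omit [DecidableEq ι] in
/-- **Markov's inequality**: for `f ≥ 0` and `θ > 0`, `P(f ≥ θ) ≤ E[f] / θ`.
[Feller I, §IX.6; Allen–O'Donnell–Witmer 2015, App. A.4 (Claim, Markov on the trace)] [folklore] -/
theorem subsetProb_le_subsetExp_div (p : ℝ) {f : Finset ι → ℝ} (hf : ∀ T, 0 ≤ f T) {θ : ℝ}
    (hθ : 0 < θ) : subsetProb ι p (fun T => θ ≤ f T) ≤ subsetExp ι p f / θ := by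
  rw [le_div_iff₀ hθ, mul_comm, subsetProb, ← subsetExp_const_mul]
  refine subsetExp_mono p fun T => ?_
  split_ifs with h
  · simpa using h
  · simpa using hf T

/-- `E[|T|] = |ι| p`: the expected number of included elements. [Allen–O'Donnell–Witmer 2015,
§3.1 (`m̄ = 2^k n^k p`)] [folklore] -/
theorem subsetExp_card {p : ℝ} (hp0 : 0 ≤ p) (hp1 : p ≤ 1) :
    subsetExp ι p (fun T => (T.card : ℝ)) = Fintype.card ι * p := by
  have hcard : ∀ T : Finset ι, (T.card : ℝ) = ∑ i, ind T i := fun T => by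
    unfold ind
    rw [Finset.sum_ite_mem, Finset.univ_inter, Finset.sum_const, nsmul_eq_mul, mul_one]
  simp only [hcard]
  rw [subsetExp_sum]
  have hi : ∀ i : ι, subsetExp ι p (fun T => ind T i) = p := by
    intro i
    have h := subsetExp_prod_centred_pow hp0 hp1 (fun i' => if i' = i then 1 else 0)
    have hl : (fun T : Finset ι => ∏ i', (ind T i' - p) ^ (if i' = i then 1 else 0)) =
        fun T => ind T i - p := by
      funext T
      rw [Finset.prod_eq_single i (fun i' _ hne => by rw [if_neg hne, pow_zero])
        (fun h => absurd (Finset.mem_univ i) h), if_pos rfl, pow_one]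
    have hr : ∏ i', bernMoment p (if i' = i then 1 else 0) = 0 :=
      Finset.prod_eq_zero (Finset.mem_univ i) (by rw [if_pos rfl, bernMoment_one])
    rw [hl, hr, subsetExp_sub, subsetExp_const hp0 hp1, sub_eq_zero] at h
    exact h
  simp only [hi, Finset.sum_const, Finset.card_univ, nsmul_eq_mul]

/-- `E[(|T| - |ι| p)²] = |ι| p (1-p)`: the variance of the number of included elements.
[Allen–O'Donnell–Witmer 2015, Fact 3.6 (concentration of `m`)] [folklore] -/
theorem subsetExp_card_sub_sq {p : ℝ} (hp0 : 0 ≤ p) (hp1 : p ≤ 1) :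
    subsetExp ι p (fun T => ((T.card : ℝ) - Fintype.card ι * p) ^ 2) =
      Fintype.card ι * (p * (1 - p)) := by
  -- `|T| - |ι| p = ∑_i (ind T i - p)`; expand the square
  have hdev : ∀ T : Finset ι, (T.card : ℝ) - Fintype.card ι * p = ∑ i, (ind T i - p) := by
    intro T
    rw [Finset.sum_sub_distrib, Finset.sum_const, Finset.card_univ, nsmul_eq_mul]
    congr 1
    unfold ind
    rw [Finset.sum_ite_mem, Finset.univ_inter, Finset.sum_const, nsmul_eq_mul, mul_one]
  simp only [hdev, sq, Finset.sum_mul_sum]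
  rw [subsetExp_sum]
  simp only [subsetExp_sum]
  -- `E[(ξ_i - p)(ξ_j - p)] = [i = j] p (1-p)`
  have hpow1 : ∀ (T : Finset ι) (i₀ : ι),
      ∏ i', (ind T i' - p) ^ (if i' = i₀ then 1 else 0) = ind T i₀ - p := fun T i₀ => by
    rw [Finset.prod_eq_single i₀ (fun i' _ hne => by rw [if_neg hne, pow_zero])
      (fun h => absurd (Finset.mem_univ _) h), if_pos rfl, pow_one]
  have hij : ∀ i j : ι, subsetExp ι p (fun T => (ind T i - p) * (ind T j - p)) =
      if i = j then p * (1 - p) else 0 := by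
    intro i j
    have h := subsetExp_prod_centred_pow hp0 hp1
      (fun i' => (if i' = i then 1 else 0) + if i' = j then 1 else 0)
    have hl : (fun T : Finset ι => ∏ i',
        (ind T i' - p) ^ ((if i' = i then 1 else 0) + if i' = j then 1 else 0)) =
        fun T => (ind T i - p) * (ind T j - p) := by
      funext T
      simp only [pow_add, Finset.prod_mul_distrib, hpow1]
    rw [hl] at h
    rw [h]
    split_ifs with hij
    · subst hij
      rw [Finset.prod_eq_single i (fun i' _ hne => by rw [if_neg hne, add_zero, bernMoment_zero])
        (fun h => absurd (Finset.mem_univ _) h), if_pos rfl]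
      exact bernMoment_two p
    · exact Finset.prod_eq_zero (Finset.mem_univ i)
        (by rw [if_pos rfl, if_neg hij, add_zero, bernMoment_one])
  simp only [hij, Finset.sum_ite_eq, Finset.mem_univ, if_true, Finset.sum_const, Finset.card_univ,
    nsmul_eq_mul]

end Literature.Computability.Complexity
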